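import Summits.Ventures.PercRepro.RankLevelSetFrameQ

/-!
# PercRepro — the CORE of the wrapper is locally sparse: lines have ≤ 3 points, planes ≤ 7 (night-1, gen 1)

`proofs/NIGHT-1-C025-induction.md` §12 (C1)(C2). The wrapper `rls_succ_all` (RankLevelSetFrameQ) leaves as its
hypothesis the simple, coloop-free, rank-`p` matroids in which EVERY element `e` admits an `e`-free partition of
`E ∖ {e}`. By the pigeonhole lemma `spans_of_pigeonhole`, such a matroid has no line with `≥ 4` points (a second
point of the line and any two of three further points span `e`) and no plane with `≥ 8` points (any `4` of `7`
further points have rank `3` by the line bound, hence span `e`). These two facts are what the counting argument of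
§12–§13 uses on the core.

* `subset_closure_of_eRk_le` — `X ⊆ Y ⊆ E`, `Y` finite, `r(Y) ≤ r(X)` ⇒ `Y ⊆ cl(X)`;
* **`ncard_le_three_of_eRk_two`** — (C1): every rank-`2` subset of the core has `≤ 3` elements;
* **`ncard_le_seven_of_eRk_three`** — (C2): every rank-`3` subset of the core has `≤ 7` elements.
Axioms: standard.
-/

namespace PercRepro

namespace ThmN

open Set

variable {α : Type}

/-- If `X ⊆ Y ⊆ E` with `Y` finite and `r(Y) ≤ r(X)`, then `Y ⊆ cl(X)`. -/
theorem subset_closure_of_eRk_le (M : Matroid α) {X Y : Set α} (hXY : X ⊆ Y) (hY : Y ⊆ M.E)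
    (hYfin : Y.Finite) (hr : M.eRk Y ≤ M.eRk X) : Y ⊆ M.closure X := by
  have hX : M.IsRkFinite X := M.isRkFinite_of_finite (hYfin.subset hXY)
  rw [hX.closure_eq_closure_of_subset_of_eRk_ge_eRk hXY hr]
  exact M.subset_closure Y hY

/-- **(C1) Lines of the core have at most `3` points**: in a simple finite matroid in which every element `e` admits an
`e`-free partition of `E ∖ {e}`, every subset of rank `2` has at most `3` elements. -/
theorem ncard_le_three_of_eRk_two (M : Matroid α) [M.Finite]
    (hs : ∀ e ∈ M.E, ∀ f ∈ M.E, e ≠ f → M.eRk {e, f} = 2)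
    (hfree : ∀ e ∈ M.E, ∃ A ⊆ M.E \ {e}, e ∉ M.closure A ∧ e ∉ M.closure ((M.E \ {e}) \ A))
    {L : Set α} (hL : L ⊆ M.E) (hr : M.eRk L = 2) : L.ncard ≤ 3 := by
  classical
  by_contra hlt
  push Not at hlt
  have hLfin : L.Finite := M.ground_finite.subset hL
  obtain ⟨e, he⟩ : L.Nonempty := by
    rw [Set.nonempty_iff_ne_empty]
    rintro rfl
    simp at hlt
  have heE : e ∈ M.E := hL he
  -- three further points of `L`
  set Lf := hLfin.toFinset with hLf
  have hLfcard : Lf.card = L.ncard := by rw [hLf, ← Set.ncard_eq_toFinset_card L hLfin]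
  have heLf : e ∈ Lf := by rw [hLf, Set.Finite.mem_toFinset]; exact he
  have h3 : 3 ≤ (Lf.erase e).card := by rw [Finset.card_erase_of_mem heLf]; omega
  obtain ⟨T, hTsub, hTcard⟩ := Finset.exists_subset_card_eq h3
  have hTL : ∀ x ∈ T, x ∈ L ∧ x ≠ e := by
    intro x hx
    have hx' := hTsub hx
    rw [Finset.mem_erase] at hx'
    refine ⟨?_, hx'.1⟩
    have := hx'.2
    rw [hLf, Set.Finite.mem_toFinset] at this
    exact this
  have hT : (T : Set α) ⊆ M.E \ {e} := by
    intro x hx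
    have hx' := hTL x (Finset.mem_coe.1 hx)
    exact ⟨hL hx'.1, by simpa using hx'.2⟩
  -- every pair of `T` spans `e`: it has rank `2 = r(L)` and lies in `L`
  have hspan : ∀ T' ⊆ T, T'.card = 2 → e ∈ M.closure (T' : Set α) := by
    intro T' hT' hT'card
    obtain ⟨x, y, hxy, rfl⟩ := Finset.card_eq_two.1 hT'card
    have hx := hTL x (hT' (Finset.mem_insert_self x {y}))
    have hy := hTL y (hT' (Finset.mem_insert_of_mem (Finset.mem_singleton_self y)))
    have hxy' : ({x, y} : Set α) ⊆ L := by
      intro z hz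
      rcases hz with rfl | rfl
      · exact hx.1
      · exact hy.1
    have hrk : M.eRk L ≤ M.eRk ({x, y} : Set α) := by
      rw [hr, hs x (hL hx.1) y (hL hy.1) hxy]
    have hsub := subset_closure_of_eRk_le M hxy' hL hLfin hrk
    rw [Finset.coe_pair]
    exact hsub he
  have hpig := spans_of_pigeonhole M T hT 2 (by omega) hspan
  obtain ⟨A, hA, h1, h2⟩ := hfree e heE
  rcases hpig A hA with h | h
  · exact h1 h
  · exact h2 h

/-- **(C2) Planes of the core have at most `7` points**: in a simple finite matroid in which every element admits an
`e`-free partition, every subset of rank `3` has at most `7` elements (any four of seven further points of a plane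
have rank `3` by (C1), hence span the plane). -/
theorem ncard_le_seven_of_eRk_three (M : Matroid α) [M.Finite]
    (hs : ∀ e ∈ M.E, ∀ f ∈ M.E, e ≠ f → M.eRk {e, f} = 2)
    (hfree : ∀ e ∈ M.E, ∃ A ⊆ M.E \ {e}, e ∉ M.closure A ∧ e ∉ M.closure ((M.E \ {e}) \ A))
    {P : Set α} (hP : P ⊆ M.E) (hr : M.eRk P = 3) : P.ncard ≤ 7 := by
  classical
  by_contra hlt
  push Not at hlt
  have hPfin : P.Finite := M.ground_finite.subset hP
  obtain ⟨e, he⟩ : P.Nonempty := by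
    rw [Set.nonempty_iff_ne_empty]
    rintro rfl
    simp at hlt
  have heE : e ∈ M.E := hP he
  set Pf := hPfin.toFinset with hPf
  have hPfcard : Pf.card = P.ncard := by rw [hPf, ← Set.ncard_eq_toFinset_card P hPfin]
  have hePf : e ∈ Pf := by rw [hPf, Set.Finite.mem_toFinset]; exact he
  have h7 : 7 ≤ (Pf.erase e).card := by rw [Finset.card_erase_of_mem hePf]; omega
  obtain ⟨T, hTsub, hTcard⟩ := Finset.exists_subset_card_eq h7
  have hTP : ∀ x ∈ T, x ∈ P ∧ x ≠ e := by
    intro x hx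
    have hx' := hTsub hx
    rw [Finset.mem_erase] at hx'
    refine ⟨?_, hx'.1⟩
    have := hx'.2
    rw [hPf, Set.Finite.mem_toFinset] at this
    exact this
  have hT : (T : Set α) ⊆ M.E \ {e} := by
    intro x hx
    have hx' := hTP x (Finset.mem_coe.1 hx)
    exact ⟨hP hx'.1, by simpa using hx'.2⟩
  -- every `4`-subset of `T` has rank `3` (a rank-`≤ 2` set has `≤ 3` elements by (C1)), so it spans `P ∋ e`
  have hspan : ∀ T' ⊆ T, T'.card = 4 → e ∈ M.closure (T' : Set α) := by
    intro T' hT' hT'card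
    have hT'P : (T' : Set α) ⊆ P := by
      intro x hx
      exact (hTP x (hT' (Finset.mem_coe.1 hx))).1
    have hT'E : (T' : Set α) ⊆ M.E := hT'P.trans hP
    have hT'ncard : (T' : Set α).ncard = 4 := by rw [Set.ncard_coe_finset, hT'card]
    have hle : M.eRk (T' : Set α) ≤ 3 := by rw [← hr]; exact M.eRk_mono hT'P
    -- rank ≥ 2: two distinct points
    have hge2 : 2 ≤ M.eRk (T' : Set α) := by
      obtain ⟨x, y, hxy, hxT', hyT'⟩ : ∃ x y, x ≠ y ∧ x ∈ T' ∧ y ∈ T' := by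
        have : 2 ≤ T'.card := by omega
        obtain ⟨S, hS, hScard⟩ := Finset.exists_subset_card_eq this
        obtain ⟨x, y, hxy, rfl⟩ := Finset.card_eq_two.1 hScard
        exact ⟨x, y, hxy, hS (Finset.mem_insert_self x {y}),
          hS (Finset.mem_insert_of_mem (Finset.mem_singleton_self y))⟩
      have hpair : ({x, y} : Set α) ⊆ (T' : Set α) := by
        intro z hz
        rcases hz with rfl | rfl
        · exact Finset.mem_coe.2 hxT'
        · exact Finset.mem_coe.2 hyT'
      rw [← hs x (hT'E (Finset.mem_coe.2 hxT')) y (hT'E (Finset.mem_coe.2 hyT')) hxy]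
      exact M.eRk_mono hpair
    -- rank ≠ 2 by (C1)
    have hne2 : M.eRk (T' : Set α) ≠ 2 := by
      intro h2
      have := ncard_le_three_of_eRk_two M hs hfree hT'E h2
      omega
    have hrk3 : M.eRk (T' : Set α) = 3 := by
      -- `2 ≤ r ≤ 3`, `r ≠ 2`, in `ℕ`
      have hfin : M.eRk (T' : Set α) ≠ ⊤ :=
        ((M.eRk_le_encard _).trans_lt (T'.finite_toSet.encard_lt_top)).ne
      obtain ⟨k, hk⟩ := ENat.ne_top_iff_exists.1 hfin
      rw [← hk] at hle hge2 hne2 ⊢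
      have h1 : k ≤ 3 := by exact_mod_cast hle
      have h2 : 2 ≤ k := by exact_mod_cast hge2
      have h3 : k ≠ 2 := by
        rintro rfl
        exact hne2 (by norm_num)
      have hk3 : k = 3 := by omega
      rw [hk3]
      norm_num
    have hrk : M.eRk P ≤ M.eRk (T' : Set α) := by rw [hr, hrk3]
    exact subset_closure_of_eRk_le M hT'P hP hPfin hrk he
  have hpig := spans_of_pigeonhole M T hT 4 (by omega) hspan
  obtain ⟨A, hA, h1, h2⟩ := hfree e heE
  rcases hpig A hA with h | h
  · exact h1 h
  · exact h2 h

end ThmN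

end PercRepro
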